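import Literature.Topology.FourManifolds.HomotopySpheresInverseHomotopy
import Literature.AlgebraicTopology.SingularHomology.LefschetzDuality
import Literature.AlgebraicTopology.SingularHomology.HomologySpheres
import Literature.AlgebraicTopology.SingularHomology.OrientationCover
import Literature.AlgebraicTopology.SingularHomology.FundamentalClassExistence
import Literature.AlgebraicTopology.SingularHomology.KroneckerDegreeOne
import Literature.AlgebraicTopology.SingularHomology.ExcisionMayerVietorisProofs
import HarnessLib

/-!
# The boundary of a contractible bounding manifold: the Poincaré duality step of Kervaire–Milnor's Lemma 2.3

Topic `Literature/Topology/FourManifolds`, sibling of `HomotopySpheresInverseHomotopy.lean`. That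
file proves the homotopy-theoretic half of Kervaire–Milnor's Lemma 2.3 (*Groups of homotopy
spheres I*, Ann. of Math. 77 (1963), pp. 506–507; tree named fact
`Literature.Topology.FourManifolds.NullCobordism.isHomotopyEquiv_compl_ball_of_contractibleSpace`)
from Whitehead's theorem, the CW homotopy type of compact manifolds, and one remaining named
fact, the **Poincaré duality step**
`Literature.Topology.FourManifolds.NullCobordism.isIso_singularHomology_map_inclToComplCenter`:
for a null-cobordism `M = ∂W` of a closed simply connected `n`-manifold, `n ≥ 2`, with `W`
contractible, and a disc `i : ℝⁿ⁺¹ → Int W`, the map `M → W ∖ {i 0}` is an isomorphism on all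
`Hₖ(-; ℤ)` (Kervaire–Milnor, p. 507: "Now applying the Poincaré duality isomorphism
`Hₖ(W, M) ≅ Hⁿ⁺¹⁻ᵏ(W, Sⁿ)`, we see that the inclusion `M → W` also induces isomorphisms of
homology groups").

This file **derives that step from the standard duality theorems** vendored (as named facts,
D-0014) in `Literature/AlgebraicTopology/SingularHomology/LefschetzDuality.lean` and
`HomologySpheres.lean`, everything else being proved:

* Spanier, *Algebraic Topology* (1966), Thm. 6.3.5 with Lemma 6.3.7
  (`relativeSingularHomology.exists_linearEquiv_of_ne_zero`): for `W` compact connected,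
  `Hₙ₊₁(W, ∂W; ℤ) ≠ 0 ⟹ Hₙ₊₁(W, ∂W; ℤ) ≅ ℤ`, generated by fundamental classes;
* Lefschetz duality, Spanier Thm. 6.3.12 / Hatcher Thm. 3.43
  (`bijective_relCapProduct_of_isRelFundamentalClass`): `a ↦ a ⌢ z : Hᵖ(W; ℤ) ≅ Hₙ₊₁₋ₚ(W, ∂W; ℤ)`;
* universal coefficients, Hatcher Thm. 3.2 (`injective_kroneckerMap_of_free`), used only to see
  that `Hᵖ(W; ℤ) = 0` for `W` contractible and `p ≥ 2` (`p = 1` is the tree theorem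
  `isZero_singularCohomology_one_of_simplyConnectedSpace`).

**Proof** (`NullCobordism.isIso_singularHomology_map_inclToComplCenter_of_lefschetz`). Write
`∂W = (𝓡∂ (n+1)).boundary W ≅ M` (`NullCobordism.bdryHomeomorph`) and `P = W ∖ {i 0}`.
(1) `Hₙ(∂W) ≅ Hₙ(M) ≅ ℤ`: `M` is `ℤ`-orientable since simply connected (Hatcher Prop. 3.25, tree
theorem `isOrientableOver_of_simplyConnectedSpace`) and closed connected (Hatcher Thm. 3.26(a),
tree theorem `nonempty_singularHomology_top_iso_holds`). (2) `W` is contractible, so the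
connecting maps `∂ : Hₖ₊₁(W, ∂W) → Hₖ(∂W)` and `∂ : Hₖ₊₁(W, P) → Hₖ(P)` are isomorphisms for
`k ≥ 1` (long exact sequences, `RelativeHomology.lean`); hence `Hₙ₊₁(W, ∂W) ≠ 0` and (Spanier
6.3.5) a generator `z` is a fundamental class. (3) Lefschetz: `Hq(W, ∂W) ≅ Hⁿ⁺¹⁻q(W) = 0` for
`q ≤ n`, so `Hⱼ(∂W) = 0` for `1 ≤ j ≤ n - 1`. (4) Degree `n`: naturality of `∂` for the map of
pairs `(W, ∂W) → (W, P)` gives `∂ ∘ ρ = ι_* ∘ ∂` with `ρ : Hₙ₊₁(W, ∂W) → Hₙ₊₁(W, P) = Hₙ₊₁(W | i 0)`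
the local image, an isomorphism because it carries the generator `z` to a generator (definition
of fundamental class); so `ι_* : Hₙ(∂W) → Hₙ(P)` is an isomorphism. (5) `Hₖ(P) ≅ Hₖ(Sⁿ)`
(`ContractiblePunctured.lean`), so in degrees `1 ≤ k ≤ n - 1` and `k > n` both sides vanish
(`isZero_singularHomology_of_lt_holds` for `M`), and degree `0` is path connectedness.

Assembled at the end: `NullCobordism.isHomotopyEquiv_compl_ball_of_contractibleSpace_of_facts`,
the homotopy-theoretic half of Lemma 2.3 from Whitehead (Hatcher Cor. 4.33), the CW type of
compact manifolds (Hatcher Cor. A.12, closed and with boundary), Spanier 6.3.5, Lefschetz duality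
and universal coefficients — six named facts of the tree, nothing else. No declaration in this
file uses `sorry`; no named fact is introduced here.

## References

* M. Kervaire, J. Milnor, *Groups of homotopy spheres I*, Ann. of Math. (2) 77 (1963), 504–537:
  proof of Lemma 2.3 (pp. 506–507). doi:10.2307/1970128 [KervaireMilnorAnnals1963]
* E. H. Spanier, *Algebraic Topology*, McGraw-Hill 1966 / Springer 1981, Ch. 6 §3: Thm. 5,
  Lemma 7, Cor. 8, Thm. 12, definition of fundamental class. [Spanier1981]
* A. Hatcher, *Algebraic Topology*, CUP (2002), Thm. 2.16 (long exact sequence of the pair),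
  Cor. 2.14, Thm. 3.2, Prop. 3.25, Thm. 3.26, Thm. 3.43, Cor. 4.33, Cor. A.12. [HatcherAT2002]
-/

noncomputable section

open scoped Manifold ContDiff Topology ContinuousMap
open CategoryTheory Limits Set Function Metric Module
open Literature.AlgebraicTopology.SingularHomology Literature.AlgebraicTopology.Homotopy

namespace Literature.Topology.FourManifolds

/-- Local notation: `𝔼 n` is the model Euclidean space `EuclideanSpace ℝ (Fin n)`. -/
local notation "𝔼 " n:arg => EuclideanSpace ℝ (Fin n)

/-- Local notation: `𝕊 n` is the unit sphere in `EuclideanSpace ℝ (Fin (n + 1))`. -/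
local notation "𝕊 " n:arg => (Metric.sphere (0 : EuclideanSpace ℝ (Fin (n + 1))) 1)

/-! ### Generalities: connecting maps, zero objects, generators of `ℤ` -/

section General

variable (R : Type) [CommRing R] (A' : Type) [AddCommGroup A'] [Module R A']
variable {X : Type} [TopologicalSpace X]

/-- If `Hₖ₊₁(X) = Hₖ(X) = 0` then the connecting map `∂ : Hₖ₊₁(X, A) → Hₖ(A)` of the pair is an
isomorphism (long exact sequence of the pair, Hatcher 2002, Thm. 2.16). [cite: HatcherAT2002, Thm. 2.16] -/
theorem isIso_δ_of_isZero (A : Set X) (k : ℕ)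
    (h₁ : IsZero (singularHomology R A' X (k + 1))) (h₀ : IsZero (singularHomology R A' X k)) :
    IsIso (relativeSingularHomology.δ R A' X A k) := by
  haveI : Mono (relativeSingularHomology.δ R A' X A k) :=
    (relativeSingularHomology.exact_ofAbsolute_δ R A' A k).mono_g (h₁.eq_of_src _ _)
  haveI : Epi (relativeSingularHomology.δ R A' X A k) :=
    (relativeSingularHomology.exact_δ_map R A' A k).epi_f (h₀.eq_of_tgt _ _)
  exact isIso_of_mono_of_epi _

/-- If `Hₖ₊₁(X, A) = 0` and `Hₖ(X) = 0` then `Hₖ(A) = 0` (long exact sequence of the pair,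
Hatcher 2002, Thm. 2.16). [cite: HatcherAT2002, Thm. 2.16] -/
theorem isZero_of_isZero_rel_of_isZero (A : Set X) (k : ℕ)
    (h₁ : IsZero (relativeSingularHomology R A' X A (k + 1)))
    (h₀ : IsZero (singularHomology R A' X k)) : IsZero (singularHomology R A' A k) := by
  haveI : Epi (relativeSingularHomology.δ R A' X A k) :=
    (relativeSingularHomology.exact_δ_map R A' A k).epi_f (h₀.eq_of_tgt _ _)
  exact IsZero.of_epi (relativeSingularHomology.δ R A' X A k) h₁

/-- A morphism between zero objects is an isomorphism. [folklore] -/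
theorem isIso_of_isZero_of_isZero {C : Type*} [Category C] [HasZeroMorphisms C] {A B : C}
    (hA : IsZero A) (hB : IsZero B) (f : A ⟶ B) : IsIso f :=
  ⟨⟨0, hA.eq_of_src _ _, hB.eq_of_src _ _⟩⟩

/-- A `ℤ`-linear map between modules isomorphic to `ℤ` which carries a generator to a generator is
bijective. [folklore] -/
theorem bijective_of_generator {P Q : Type*} [AddCommGroup P] [Module ℤ P] [AddCommGroup Q]
    [Module ℤ Q] (f : P →ₗ[ℤ] Q) (e : P ≃ₗ[ℤ] ℤ) (e' : Q ≃ₗ[ℤ] ℤ) (h : e' (f (e.symm 1)) = 1) :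
    Function.Bijective f := by
  set L : ℤ →ₗ[ℤ] ℤ := e'.toLinearMap ∘ₗ f ∘ₗ e.symm.toLinearMap with hL
  have hL1 : L = LinearMap.id := by
    apply LinearMap.ext_ring
    simpa [hL] using h
  have key : ∀ x, e' (f x) = e x := fun x => by
    have := LinearMap.congr_fun hL1 (e x)
    simpa [hL] using this
  refine ⟨fun x y hxy => ?_, fun y => ⟨e.symm (e' y), ?_⟩⟩
  · have h' := congrArg e' hxy
    rw [key, key] at h'
    exact e.injective h'
  · apply e'.injective
    rw [key, LinearEquiv.apply_symm_apply]

end General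

/-! ### The boundary of a contractible null-cobordism -/

namespace NullCobordism

variable {n : ℕ} {M : Type} [TopologicalSpace M] [ChartedSpace (𝔼 n) M] (c : NullCobordism n M)

/-- **The boundary of `W` is `M`**: the boundary inclusion as a homeomorphism onto
`∂W = (𝓡∂ (n + 1)).boundary W`. [folklore] -/
def bdryHomeomorph : M ≃ₜ ↥((𝓡∂ (n + 1)).boundary c.W) :=
  c.isSmoothEmbedding_incl.isEmbedding.toHomeomorph.trans (Homeomorph.setCongr c.range_incl)

/-- The value of `bdryHomeomorph`. [folklore] -/
@[simp] theorem coe_bdryHomeomorph (x : M) : (c.bdryHomeomorph x : c.W) = c.incl x := rfl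

/-- The boundary `∂W ≅ M` is path connected when `M` is. [folklore] -/
theorem pathConnectedSpace_boundary [PathConnectedSpace M] :
    PathConnectedSpace ↥((𝓡∂ (n + 1)).boundary c.W) := by
  rw [pathConnectedSpace_iff_univ, ← c.bdryHomeomorph.range_eq_univ]
  exact isPathConnected_range c.bdryHomeomorph.continuous

/-- **`Hₙ(∂W; ℤ) ≅ ℤ`** for `M` closed and simply connected: `∂W ≅ M` is a closed connected
`n`-manifold, `ℤ`-orientable because simply connected (Hatcher 2002, Prop. 3.25, tree theorem
`isOrientableOver_of_simplyConnectedSpace`), so `Hₙ ≅ ℤ` (Hatcher Thm. 3.26(a), tree theorem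
`nonempty_singularHomology_top_iso_holds`). [cite: HatcherAT2002, Thm. 3.26(a) and Prop. 3.25] -/
theorem nonempty_singularHomology_boundary_iso [T2Space M] [CompactSpace M] [SimplyConnectedSpace M] :
    Nonempty (singularHomology ℤ ℤ ↥((𝓡∂ (n + 1)).boundary c.W) n ≅ ModuleCat.of ℤ (ULift ℤ)) := by
  obtain ⟨μ⟩ : IsOrientableOver ℤ M n := isOrientableOver_of_simplyConnectedSpace ℤ M
  obtain ⟨e⟩ := nonempty_singularHomology_top_iso_holds (R := ℤ) (X := M) n μ
  exact ⟨(singularHomology.mapIso ℤ ℤ c.bdryHomeomorph n).symm ≪≫ e⟩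

/-- `Hₖ(∂W; ℤ) = 0` for `k > n` (`∂W ≅ M` a closed `n`-manifold; Hatcher Thm. 3.26(c), tree
theorem `isZero_singularHomology_of_lt_holds`). [cite: HatcherAT2002, Thm. 3.26(c)] -/
theorem isZero_singularHomology_boundary_of_lt [T2Space M] [CompactSpace M] {k : ℕ} (hk : n < k) :
    IsZero (singularHomology ℤ ℤ ↥((𝓡∂ (n + 1)).boundary c.W) k) :=
  (isZero_singularHomology_of_lt_holds (R := ℤ) (M := ℤ) (X := M) n hk).of_iso
    (singularHomology.mapIso ℤ ℤ c.bdryHomeomorph k).symm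

/-- **`∂ : Hₖ₊₁(W, ∂W) ≅ Hₖ(∂W)`** for `W` contractible and `k ≥ 1`. [folklore] -/
theorem isIso_δ_boundary [ContractibleSpace c.W] {k : ℕ} (hk : k ≠ 0) :
    IsIso (relativeSingularHomology.δ ℤ ℤ c.W ((𝓡∂ (n + 1)).boundary c.W) k) :=
  isIso_δ_of_isZero ℤ ℤ _ k (isZero_singularHomology_of_contractibleSpace ℤ ℤ k.succ_ne_zero)
    (isZero_singularHomology_of_contractibleSpace ℤ ℤ hk)

/-- **`Hₙ₊₁(W, ∂W; ℤ) ≠ 0`** for `W` contractible with closed simply connected boundary `M`,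
`n ≥ 1`: `Hₙ₊₁(W, ∂W) ≅ Hₙ(∂W) ≅ ℤ`. [folklore] -/
theorem exists_ne_zero_relativeSingularHomology [T2Space M] [CompactSpace M] [SimplyConnectedSpace M]
    [ContractibleSpace c.W] (hn : 1 ≤ n) :
    ∃ z : relativeSingularHomology ℤ ℤ c.W ((𝓡∂ (n + 1)).boundary c.W) (n + 1), z ≠ 0 := by
  haveI := c.isIso_δ_boundary (k := n) (by omega)
  obtain ⟨e⟩ := c.nonempty_singularHomology_boundary_iso
  let E := asIso (relativeSingularHomology.δ ℤ ℤ c.W ((𝓡∂ (n + 1)).boundary c.W) n) ≪≫ e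
  refine ⟨E.toLinearEquiv.symm (ULift.up 1), fun h => ?_⟩
  have h' := congrArg E.toLinearEquiv h
  rw [LinearEquiv.apply_symm_apply, map_zero] at h'
  exact one_ne_zero (ULift.up_injective h')

/-- **The positive-degree cohomology of a contractible space vanishes**, GIVEN universal
coefficients (`injective_kroneckerMap_of_free`, Hatcher 2002, Thm. 3.2): `Hᵖ(W; ℤ) ↪
Hom(Hₚ(W), ℤ) = 0` for `p ≥ 1` since `Hₚ₋₁(W; ℤ)` is free (`ℤ` or `0`). In degree `1` this is the
tree theorem `isZero_singularCohomology_one_of_simplyConnectedSpace` (no hypothesis needed).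
[cite: HatcherAT2002, Thm. 3.2 and p. 196] -/
theorem isZero_singularCohomology_of_contractibleSpace {W : Type} [TopologicalSpace W]
    [ContractibleSpace W] (hU : ∀ k : ℕ, injective_kroneckerMap_of_free ℤ W k) {p : ℕ}
    (hp : p ≠ 0) : IsZero (singularCohomology ℤ ℤ W p) := by
  obtain ⟨p', rfl⟩ : ∃ p', p = p' + 1 := ⟨p - 1, by omega⟩
  refine isZero_singularCohomology_of_isZero_of_free (hU p') ?_
    (isZero_singularHomology_of_contractibleSpace ℤ ℤ p'.succ_ne_zero)
  rcases Nat.eq_zero_or_pos p' with rfl | hp'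
  · exact free_singularHomology_zero
  · haveI : Subsingleton (singularHomology ℤ ℤ W p') :=
      ModuleCat.subsingleton_of_isZero (isZero_singularHomology_of_contractibleSpace ℤ ℤ hp'.ne')
    exact Module.Free.of_subsingleton ℤ _

/-- **Lefschetz duality for a contractible bounding manifold: `Hq(W, ∂W; ℤ) = 0` for `q ≤ n`.**
GIVEN a fundamental class `z ∈ Hₙ₊₁(W, ∂W; ℤ)` for which Lefschetz duality holds
(`bijective_relCapProduct_of_isRelFundamentalClass`, Spanier 1966, Thm. 6.3.12 / Hatcher
Thm. 3.43: `a ↦ a ⌢ z : Hᵖ(W) ≅ Hₙ₊₁₋ₚ(W, ∂W)`) and universal coefficients (`hU`), the relative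
groups `Hq(W, ∂W; ℤ)`, `q ≤ n`, vanish with `Hᵖ(W; ℤ)`, `p = n + 1 - q ≥ 1`.
[cite: Spanier1981, Ch. 6 Sec. 3 Thm. 12] -/
theorem isZero_relativeSingularHomology_boundary_of_lefschetz [ContractibleSpace c.W]
    (hU : ∀ k : ℕ, injective_kroneckerMap_of_free ℤ c.W k)
    (z : relativeSingularHomology ℤ ℤ c.W ((𝓡∂ (n + 1)).boundary c.W) (n + 1))
    (hz : IsRelFundamentalClass ℤ ((𝓡∂ (n + 1)).boundary c.W) z)
    (hL : ∀ (p q : ℕ) (h : p + q = n + 1),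
      bijective_relCapProduct_of_isRelFundamentalClass ℤ n c.W z hz h)
    {q : ℕ} (hq : q ≤ n) :
    IsZero (relativeSingularHomology ℤ ℤ c.W ((𝓡∂ (n + 1)).boundary c.W) q) := by
  have hb := hL (n + 1 - q) q (by omega)
  haveI : Subsingleton (singularCohomology ℤ ℤ c.W (n + 1 - q)) :=
    ModuleCat.subsingleton_of_isZero
      (isZero_singularCohomology_of_contractibleSpace hU (by omega))
  haveI : Subsingleton (relativeSingularHomology ℤ ℤ c.W ((𝓡∂ (n + 1)).boundary c.W) q) :=
    hb.surjective.subsingleton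
  exact ModuleCat.isZero_iff_subsingleton.mpr inferInstance

/-- **The boundary of a contractible manifold is a homology sphere below the top degree**:
`Hⱼ(∂W; ℤ) = 0` for `1 ≤ j ≤ n - 1`, GIVEN Lefschetz duality for a fundamental class `z` and
universal coefficients: `Hⱼ₊₁(W, ∂W) = 0 → Hⱼ(∂W) → Hⱼ(W) = 0` (Kervaire–Milnor 1963, proof of
Lemma 2.3, the Poincaré duality step). [cite: KervaireMilnorAnnals1963, Lemma 2.3, proof (pp. 506–507)] -/
theorem isZero_singularHomology_boundary_of_lefschetz [ContractibleSpace c.W]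
    (hU : ∀ k : ℕ, injective_kroneckerMap_of_free ℤ c.W k)
    (z : relativeSingularHomology ℤ ℤ c.W ((𝓡∂ (n + 1)).boundary c.W) (n + 1))
    (hz : IsRelFundamentalClass ℤ ((𝓡∂ (n + 1)).boundary c.W) z)
    (hL : ∀ (p q : ℕ) (h : p + q = n + 1),
      bijective_relCapProduct_of_isRelFundamentalClass ℤ n c.W z hz h)
    {j : ℕ} (hj : 1 ≤ j) (hjn : j + 1 ≤ n) :
    IsZero (singularHomology ℤ ℤ ↥((𝓡∂ (n + 1)).boundary c.W) j) :=
  isZero_of_isZero_rel_of_isZero ℤ ℤ _ j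
    (c.isZero_relativeSingularHomology_boundary_of_lefschetz hU z hz hL hjn)
    (isZero_singularHomology_of_contractibleSpace ℤ ℤ (by omega))

end NullCobordism

/-! ### The inclusion `∂W ↪ W ∖ {i 0}` -/

namespace BallRemovalData

variable {n : ℕ} {M : Type} [TopologicalSpace M] [ChartedSpace (𝔼 n) M]
  (c : NullCobordism n M) (D : BallRemovalData n c.W)

/-- The centre of the removed ball is not a boundary point. [folklore] -/
theorem center_not_mem_boundary : D.i 0 ∉ (𝓡∂ (n + 1)).boundary c.W :=
  D.not_isBoundaryPoint_i 0

/-- The boundary lies in the point complement `W ∖ {i 0}`. [folklore] -/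
theorem mapsTo_boundary_complCenter :
    MapsTo (ContinuousMap.id c.W) ((𝓡∂ (n + 1)).boundary c.W) ({D.i 0}ᶜ : Set c.W) :=
  fun x hx h => D.center_not_mem_boundary c (by rw [ContinuousMap.id_apply] at h; exact h ▸ hx)

/-- **The inclusion `∂W ↪ W ∖ {i 0}`**. [folklore] -/
def bdryToComplCenter : C(↥((𝓡∂ (n + 1)).boundary c.W), ↥(({D.i 0}ᶜ : Set c.W))) :=
  subsetRestrict (ContinuousMap.id c.W) (D.mapsTo_boundary_complCenter c)

/-- `inclToComplCenter` is `∂W ↪ W ∖ {i 0}` precomposed with `M ≅ ∂W`. [folklore] -/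
theorem inclToComplCenter_eq :
    D.inclToComplCenter c = (D.bdryToComplCenter c).comp (c.bdryHomeomorph : C(_, _)) := by
  ext x : 1
  rfl

/-- The centre as a point of the complement of the boundary. [folklore] -/
def centerPt : ↥((𝓡∂ (n + 1)).boundary c.W)ᶜ := ⟨D.i 0, D.center_not_mem_boundary c⟩

/-- **`∂ : Hₖ₊₁(W, W ∖ {i 0}) ≅ Hₖ(W ∖ {i 0})`** for `W` contractible and `k ≥ 1`. [folklore] -/
theorem isIso_δ_complCenter [ContractibleSpace c.W] {k : ℕ} (hk : k ≠ 0) :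
    IsIso (relativeSingularHomology.δ ℤ ℤ c.W ({D.i 0}ᶜ : Set c.W) k) :=
  isIso_δ_of_isZero ℤ ℤ _ k (isZero_singularHomology_of_contractibleSpace ℤ ℤ k.succ_ne_zero)
    (isZero_singularHomology_of_contractibleSpace ℤ ℤ hk)

/-- **The restriction `Hₙ₊₁(W, ∂W) → Hₙ₊₁(W, W ∖ {i 0})` is an isomorphism** for a fundamental
class generating `Hₙ₊₁(W, ∂W) ≅ ℤ` (`W` contractible, `n ≥ 1`): the local image of the generator
`z` at the interior point `i 0` generates `Hₙ₊₁(W | i 0) ≅ ℤ` (definition of a fundamental class,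
Spanier 1966, 6.3), and `Hₙ₊₁(W, W ∖ {i 0}) ≅ Hₙ(W ∖ {i 0}) ≅ Hₙ(Sⁿ) ≅ ℤ`. [cite: Spanier1981, Ch. 6 Sec. 3 (definition of fundamental class)] -/
theorem isIso_toLocal_of_isRelFundamentalClass
    (e : relativeSingularHomology ℤ ℤ c.W ((𝓡∂ (n + 1)).boundary c.W) (n + 1) ≃ₗ[ℤ] ℤ)
    (hz : IsRelFundamentalClass ℤ ((𝓡∂ (n + 1)).boundary c.W) (e.symm 1)) :
    IsIso (relativeSingularHomology.toLocal ℤ ℤ ((𝓡∂ (n + 1)).boundary c.W) (D.centerPt c)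
      (n + 1)) := by
  obtain ⟨e', he'⟩ := hz (D.centerPt c)
  exact (ConcreteCategory.isIso_iff_bijective _).2
    (bijective_of_generator (relativeSingularHomology.toLocal ℤ ℤ ((𝓡∂ (n + 1)).boundary c.W)
      (D.centerPt c) (n + 1)).hom e e' he')

/-- **Top degree**: `∂W ↪ W ∖ {i 0}` is an isomorphism on `Hₙ(-; ℤ)` for `W` contractible,
`n ≥ 1`, and a fundamental class generating `Hₙ₊₁(W, ∂W) ≅ ℤ`: in the commutative square of
connecting maps `Hₙ₊₁(W, ∂W) → Hₙ₊₁(W, W ∖ {i 0})` over `Hₙ(∂W) → Hₙ(W ∖ {i 0})` (naturality of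
`∂`, `relativeSingularHomology.δ_naturality`) the other three maps are isomorphisms. [folklore] -/
theorem isIso_singularHomology_map_bdryToComplCenter_top [ContractibleSpace c.W] (hn : 1 ≤ n)
    (e : relativeSingularHomology ℤ ℤ c.W ((𝓡∂ (n + 1)).boundary c.W) (n + 1) ≃ₗ[ℤ] ℤ)
    (hz : IsRelFundamentalClass ℤ ((𝓡∂ (n + 1)).boundary c.W) (e.symm 1)) :
    IsIso (singularHomology.map ℤ ℤ (D.bdryToComplCenter c) n) := by
  have hsq := relativeSingularHomology.δ_naturality ℤ ℤ (ContinuousMap.id c.W)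
    (D.mapsTo_boundary_complCenter c) n
  -- `hsq : δ_∂W ≫ map ι = ρ ≫ δ_P`
  haveI := c.isIso_δ_boundary (k := n) (by omega)
  haveI := D.isIso_δ_complCenter c (k := n) (by omega)
  haveI : IsIso (relativeSingularHomology.map ℤ ℤ (ContinuousMap.id c.W)
      (D.mapsTo_boundary_complCenter c) (n + 1)) :=
    D.isIso_toLocal_of_isRelFundamentalClass c e hz
  have heq : singularHomology.map ℤ ℤ (D.bdryToComplCenter c) n =
      inv (relativeSingularHomology.δ ℤ ℤ c.W ((𝓡∂ (n + 1)).boundary c.W) n) ≫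
        (relativeSingularHomology.map ℤ ℤ (ContinuousMap.id c.W)
          (D.mapsTo_boundary_complCenter c) (n + 1) ≫
          relativeSingularHomology.δ ℤ ℤ c.W ({D.i 0}ᶜ : Set c.W) n) := by
    rw [← hsq, IsIso.inv_hom_id_assoc]
    rfl
  rw [heq]
  infer_instance

/-- `Hₖ(W ∖ {i 0}; ℤ) = 0` for `k ≠ 0, n` (`W` contractible, `n ≥ 1`): it is `Hₖ(Sⁿ; ℤ)`
(`isIso_singularHomology_map_sphereToComplCenter`, Mayer–Vietoris; Hatcher Cor. 2.14).
[cite: HatcherAT2002, Cor. 2.14 and §2.2] -/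
theorem isZero_singularHomology_complCenter [ContractibleSpace c.W] (hn : 1 ≤ n) {k : ℕ}
    (hk : k ≠ 0) (hkn : k ≠ n) : IsZero (singularHomology ℤ ℤ ↥(({D.i 0}ᶜ : Set c.W)) k) := by
  haveI := isIso_singularHomology_map_sphereToComplCenter ℤ ℤ D.isOpenEmbedding_i hn k
  exact (isZero_singularHomology_unitSphere (R := ℤ) (M := ℤ) n k hk hkn).of_iso
    (asIso (singularHomology.map ℤ ℤ (sphereToComplCenter D.isOpenEmbedding_i.isEmbedding) k)).symm

/-- **`∂W ↪ W ∖ {i 0}` is a homology isomorphism in every degree**, for `W` contractible with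
closed simply connected boundary `M`, `n ≥ 2`, GIVEN universal coefficients for `W` and Lefschetz
duality for a fundamental class generating `Hₙ₊₁(W, ∂W; ℤ) ≅ ℤ`: degree `0` by path
connectedness, degrees `1 ≤ k ≤ n - 1` and `k > n` because both groups vanish, degree `n` by
`isIso_singularHomology_map_bdryToComplCenter_top`. [cite: KervaireMilnorAnnals1963, Lemma 2.3, proof (pp. 506–507)] -/
theorem isIso_singularHomology_map_bdryToComplCenter [T2Space M] [CompactSpace M]
    [SimplyConnectedSpace M] [ContractibleSpace c.W] (hn : 2 ≤ n)
    (hU : ∀ k : ℕ, injective_kroneckerMap_of_free ℤ c.W k)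
    (e : relativeSingularHomology ℤ ℤ c.W ((𝓡∂ (n + 1)).boundary c.W) (n + 1) ≃ₗ[ℤ] ℤ)
    (hz : IsRelFundamentalClass ℤ ((𝓡∂ (n + 1)).boundary c.W) (e.symm 1))
    (hL : ∀ (p q : ℕ) (h : p + q = n + 1),
      bijective_relCapProduct_of_isRelFundamentalClass ℤ n c.W (e.symm 1) hz h) (k : ℕ) :
    IsIso (singularHomology.map ℤ ℤ (D.bdryToComplCenter c) k) := by
  rcases Nat.eq_zero_or_pos k with rfl | hk0
  · -- degree 0
    haveI := c.pathConnectedSpace_boundary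
    haveI := pathConnectedSpace_compl_center D.isOpenEmbedding_i (by omega : 1 ≤ n)
    exact singularHomology.isIso_map_zero_of_pathConnectedSpace ℤ ℤ _
  rcases lt_trichotomy k n with hkn | rfl | hnk
  · -- 1 ≤ k ≤ n - 1
    exact isIso_of_isZero_of_isZero
      (c.isZero_singularHomology_boundary_of_lefschetz hU _ hz hL hk0 (by omega))
      (D.isZero_singularHomology_complCenter c (by omega) hk0.ne' hkn.ne) _
  · -- k = n
    exact D.isIso_singularHomology_map_bdryToComplCenter_top c (by omega) e hz
  · -- k > n
    exact isIso_of_isZero_of_isZero (c.isZero_singularHomology_boundary_of_lt hnk)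
      (D.isZero_singularHomology_complCenter c (by omega) hk0.ne' hnk.ne') _

end BallRemovalData

/-! ### Discharge of the duality step from the Lefschetz duality facts -/

namespace NullCobordism

/-- **The Poincaré duality step of Kervaire–Milnor's Lemma 2.3 from Lefschetz duality.** The named
fact `NullCobordism.isIso_singularHomology_map_inclToComplCenter` (`M = ∂W → W ∖ {i 0}` is a
homology isomorphism for `W` contractible, `M` closed simply connected, `n ≥ 2`;
Kervaire–Milnor 1963, p. 507: "applying the Poincaré duality isomorphism … the inclusion `M → W`
also induces isomorphisms of homology groups") follows from three named facts of the tree's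
singular homology library, taken as hypotheses: Spanier's Thm. 6.3.5
(`relativeSingularHomology.exists_linearEquiv_of_ne_zero`: `Hₙ₊₁(W, ∂W; ℤ) ≠ 0 ⟹ ≅ ℤ`, generated
by fundamental classes), Lefschetz duality (Spanier Thm. 6.3.12 / Hatcher Thm. 3.43,
`bijective_relCapProduct_of_isRelFundamentalClass`) and universal coefficients (Hatcher Thm. 3.2,
`injective_kroneckerMap_of_free`, for the vanishing of `Hᵖ(W; ℤ)`, `p ≥ 2`). Proof:
`Hₙ₊₁(W, ∂W) ≅ Hₙ(∂W) ≅ Hₙ(M) ≅ ℤ ≠ 0` (`M` is `ℤ`-orientable, being simply connected), so a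
generator `z` is a fundamental class; `Hq(W, ∂W) ≅ Hⁿ⁺¹⁻q(W) = 0` for `q ≤ n`, whence
`Hⱼ(∂W) = 0` for `1 ≤ j ≤ n - 1`; in degree `n` the square of connecting maps; degrees `0` and
`> n` directly (`BallRemovalData.isIso_singularHomology_map_bdryToComplCenter`).
[cite: KervaireMilnorAnnals1963, Lemma 2.3, proof (pp. 506–507)] -/
theorem isIso_singularHomology_map_inclToComplCenter_of_lefschetz
    (h635 : ∀ (n : ℕ) (W : Type) [TopologicalSpace W] [T2Space W] [CompactSpace W]
      [ConnectedSpace W] [ChartedSpace (EuclideanHalfSpace (n + 1)) W]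
      (h : ∃ z : relativeSingularHomology ℤ ℤ W ((𝓡∂ (n + 1)).boundary W) (n + 1), z ≠ 0),
      relativeSingularHomology.exists_linearEquiv_of_ne_zero ℤ n W h)
    (h6312 : ∀ (n : ℕ) (W : Type) [TopologicalSpace W] [T2Space W] [CompactSpace W]
      [ChartedSpace (EuclideanHalfSpace (n + 1)) W]
      (z : relativeSingularHomology ℤ ℤ W ((𝓡∂ (n + 1)).boundary W) (n + 1))
      (hz : IsRelFundamentalClass ℤ ((𝓡∂ (n + 1)).boundary W) z) (p q : ℕ) (h : p + q = n + 1),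
      bijective_relCapProduct_of_isRelFundamentalClass ℤ n W z hz h)
    (hUCT : ∀ (W : Type) [TopologicalSpace W] (k : ℕ), injective_kroneckerMap_of_free ℤ W k) :
    NullCobordism.isIso_singularHomology_map_inclToComplCenter := by
  intro n M _ _ _ _ _ _ _ c hn hc D k
  haveI := hc
  -- a generator of `Hₙ₊₁(W, ∂W) ≅ ℤ` is a fundamental class
  obtain ⟨e, he⟩ := h635 n c.W (c.exists_ne_zero_relativeSingularHomology (by omega))
  have hz : IsRelFundamentalClass ℤ ((𝓡∂ (n + 1)).boundary c.W) (e.symm 1) :=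
    he _ (by rw [LinearEquiv.apply_symm_apply]; exact isUnit_one)
  haveI := D.isIso_singularHomology_map_bdryToComplCenter c hn (hUCT c.W) e hz
    (fun p q h => h6312 n c.W (e.symm 1) hz p q h) k
  rw [D.inclToComplCenter_eq c, singularHomology.map_comp, ← singularHomology.mapIso_hom]
  infer_instance

/-- **The homotopy-theoretic half of Kervaire–Milnor's Lemma 2.3 from standard facts only**:
the named fact `NullCobordism.isHomotopyEquiv_compl_ball_of_contractibleSpace`
(`HomotopySpheresInverse.lean`) follows from Whitehead's theorem (Hatcher Cor. 4.33), the CW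
homotopy type of compact manifolds without and with boundary (Hatcher Cor. A.12), Spanier's
Thm. 6.3.5, Lefschetz duality (Spanier Thm. 6.3.12) and universal coefficients (Hatcher Thm. 3.2)
— all named facts of the tree — everything else being proved
(`isHomotopyEquiv_compl_ball_of_contractibleSpace_of_whitehead`,
`isIso_singularHomology_map_inclToComplCenter_of_lefschetz`).
[cite: KervaireMilnorAnnals1963, Lemma 2.3, proof (pp. 506–507)] -/
theorem isHomotopyEquiv_compl_ball_of_contractibleSpace_of_facts
    (hW : whitehead_exists_homotopyEquiv.{0})
    (hCW : exists_cwComplex_homotopyEquiv_of_compactSpace.{0})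
    (hCW' : exists_cwComplex_homotopyEquiv_of_compactSpace_boundary.{0})
    (h635 : ∀ (n : ℕ) (W : Type) [TopologicalSpace W] [T2Space W] [CompactSpace W]
      [ConnectedSpace W] [ChartedSpace (EuclideanHalfSpace (n + 1)) W]
      (h : ∃ z : relativeSingularHomology ℤ ℤ W ((𝓡∂ (n + 1)).boundary W) (n + 1), z ≠ 0),
      relativeSingularHomology.exists_linearEquiv_of_ne_zero ℤ n W h)
    (h6312 : ∀ (n : ℕ) (W : Type) [TopologicalSpace W] [T2Space W] [CompactSpace W]
      [ChartedSpace (EuclideanHalfSpace (n + 1)) W]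
      (z : relativeSingularHomology ℤ ℤ W ((𝓡∂ (n + 1)).boundary W) (n + 1))
      (hz : IsRelFundamentalClass ℤ ((𝓡∂ (n + 1)).boundary W) z) (p q : ℕ) (h : p + q = n + 1),
      bijective_relCapProduct_of_isRelFundamentalClass ℤ n W z hz h)
    (hUCT : ∀ (W : Type) [TopologicalSpace W] (k : ℕ), injective_kroneckerMap_of_free ℤ W k) :
    NullCobordism.isHomotopyEquiv_compl_ball_of_contractibleSpace :=
  isHomotopyEquiv_compl_ball_of_contractibleSpace_of_whitehead hW hCW hCW'
    (isIso_singularHomology_map_inclToComplCenter_of_lefschetz h635 h6312 hUCT)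

end NullCobordism

end Literature.Topology.FourManifolds

end
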